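import Literature.Analysis.FluidPDE.OseenKernelSectorBounds
import Literature.Analysis.FluidPDE.OseenSchemeComplexContinuity
import Literature.Analysis.Complex.HolomorphicParametricIntegral
import HarnessLib

/-!
# The flat complex continuation of heat potentials of bounded fields

Analysis/FluidPDE definitions-layer file for the proof of the named fact
`Literature.Analysis.FluidPDE.bradshawGrujicKukavica2015_local_analyticity_radius`
(Bradshaw–Grujić–Kukavica 2015, Thm. 2.3; the free term `e^{(t-s₀)Δ}a(s₀)` of the localised
integral equation, §4 (4.2)). For a bounded measurable field `a : ℝ^ι → ℝ^ι` and a real root time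
`ρ = √τ > 0` we define the **flat continuation of the heat potential**

  `heatPotentialC ρ a ζ = ∫ heatKernelC ρ (ζ - cx w) • cx (a w) dw`     (`ζ ∈ ℂ^ι`)

with the complexified Gaussian `heatKernelC` of `OseenKernelComplex.lean` ("flat": the contour of
integration stays `ℝ^ι`, only the kernel is continued). We prove:

* `heatPotentialC_sqrt_complexify` — **real restriction**: `heatPotentialC √τ a (cx x) = cx (e^{τΔ}a)(x)`;
* `norm_heatPotentialC_le` — **the free-term estimate**: for `‖a‖ ≤ M` and `‖y‖ ≤ ρ`,
  `‖heatPotentialC ρ a (cx x + i cx y)‖ ≤ e² (25/6)^{d/2} M` (the complexified Gaussian at an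
  admissible imaginary shift is dominated by the real Gaussian at the dilated time `(25/6)ρ²`,
  `lintegral_heatKernelC_imShift_le` of `OseenKernelSectorBounds.lean`; Lemarié-Rieusset 2016,
  proof of Thm. 9.12, p. 262);
* `differentiableOn_heatPotentialC` — **holomorphy** on every open set of points
  `cx x + i cx y` with `‖y‖ < ρ` and `x` in a fixed ball (holomorphy of dominated parameter
  integrals; the dominating function is a Gaussian envelope over the ball).

## References

* Z. Bradshaw, Z. Grujić, I. Kukavica, J. Differential Equations 259 (2015), §3–§4.
  [BradshawGrujicKukavica2015]
* P. G. Lemarié-Rieusset, *The Navier–Stokes Problem in the 21st Century*, CRC Press 2016,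
  Thm. 9.12 (proof, pp. 261–262: the holomorphic extension of `W_{νt} ∗ u₀`). [LemarieRieusset2016]
-/

noncomputable section

open MeasureTheory Set Filter Metric Real
open _root_.Topology
open scoped BigOperators ENNReal

namespace Literature.Analysis.FluidPDE

open Literature.Analysis.FunctionSpaces.EuclideanSpace (complexify complexify_apply norm_complexify
  continuous_complexify)
open UnboundedOperators (heatKernel heatExtension)

variable {ι : Type*} [Fintype ι]

/-! ### Definition and real restriction -/

/-- **The flat continuation of the heat potential** of a field `a : ℝ^ι → ℝ^ι` at real root time
`ρ`: `heatPotentialC ρ a ζ = ∫ heatKernelC ρ (ζ - cx w) • cx (a w) dw`. For `ρ = √τ` and real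
`ζ = cx x` this is `cx (e^{τΔ}a)(x)` (`heatPotentialC_sqrt_complexify`).
[cite: LemarieRieusset2016, Thm. 9.12 (proof, p. 261)] -/
def heatPotentialC (ρ : ℝ) (a : EuclideanSpace ℝ ι → EuclideanSpace ℝ ι) (ζ : EuclideanSpace ℂ ι) :
    EuclideanSpace ℂ ι :=
  ∫ w, heatKernelC (ρ : ℂ) (ζ - complexify w) • complexify (a w)

/-- Unfolding lemma. [folklore] -/
theorem heatPotentialC_apply (ρ : ℝ) (a : EuclideanSpace ℝ ι → EuclideanSpace ℝ ι)
    (ζ : EuclideanSpace ℂ ι) :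
    heatPotentialC ρ a ζ = ∫ w, heatKernelC (ρ : ℂ) (ζ - complexify w) • complexify (a w) := rfl

/-- **Real restriction**: `heatPotentialC √τ a (cx x) = cx (e^{τΔ}a)(x)` for `τ > 0` (no
hypothesis on `a`: `cx` is an isometry and both sides use the same Bochner integral). [folklore] -/
theorem heatPotentialC_sqrt_complexify (a : EuclideanSpace ℝ ι → EuclideanSpace ℝ ι) {τ : ℝ} (hτ : 0 < τ)
    (x : EuclideanSpace ℝ ι) :
    heatPotentialC (Real.sqrt τ) a (complexify x) = complexify (heatExtension a τ x) := by
  rw [heatPotentialC_apply, UnboundedOperators.heatExtension_eq_integral_sub,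
    ← (complexify (ι := ι)).integral_comp_comm (fun w => heatKernel τ (x - w) • a w)]
  refine integral_congr_ae (Eventually.of_forall fun w => ?_)
  show heatKernelC (Real.sqrt τ : ℂ) (complexify x - complexify w) • complexify (a w) =
    complexify (heatKernel τ (x - w) • a w)
  rw [← map_sub, heatKernelC_sqrt_complexify hτ, complexify_smul]

/-! ### The free-term estimate -/

/-- The displacement `cx x + i cx y - cx w = cx (x - w) - i cx (-y)`. [folklore] -/
theorem complexify_add_I_smul_sub (x y w : EuclideanSpace ℝ ι) :
    complexify x + Complex.I • complexify y - complexify w =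
      complexify (x - w) - Complex.I • complexify (-y) := by
  rw [map_sub, LinearIsometry.map_neg, smul_neg, sub_neg_eq_add]
  abel

/-- Measurability of the flat integrand at a point with `ρ ≠ 0`. [folklore] -/
theorem aestronglyMeasurable_heatPotentialC_integrand {a : EuclideanSpace ℝ ι → EuclideanSpace ℝ ι}
    (ha : AEStronglyMeasurable a volume) {ρ : ℝ} (hρ : ρ ≠ 0) (ζ : EuclideanSpace ℂ ι) :
    AEStronglyMeasurable (fun w => heatKernelC (ρ : ℂ) (ζ - complexify w) • complexify (a w)) volume := by
  have hK : Differentiable ℂ fun ξ : EuclideanSpace ℂ ι => heatKernelC (ρ : ℂ) ξ := fun ξ =>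
    (differentiableAt_const _).heatKernelC differentiableAt_id (Complex.ofReal_ne_zero.2 hρ)
  have h1 : Continuous fun w : EuclideanSpace ℝ ι => heatKernelC (ρ : ℂ) (ζ - complexify w) :=
    hK.continuous.comp (continuous_const.sub (continuous_complexify (ι := ι)))
  exact h1.aestronglyMeasurable.smul (continuous_complexify.comp_aestronglyMeasurable ha)

/-- **Pointwise domination of the flat integrand** at `cx x + i cx y`, `‖y‖ ≤ ρ`:
`‖heatKernelC ρ (cx x + i cx y - cx w) • cx (a w)‖ ≤ e²(25/6)^{d/2} G_{(25/6)ρ²}(x - w) ‖a w‖`.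
[folklore] -/
theorem norm_heatPotentialC_integrand_le {ρ : ℝ} (hρ : 0 < ρ) {x y : EuclideanSpace ℝ ι}
    (hy : ‖y‖ ≤ ρ) (a : EuclideanSpace ℝ ι → EuclideanSpace ℝ ι) (w : EuclideanSpace ℝ ι) :
    ‖heatKernelC (ρ : ℂ) (complexify x + Complex.I • complexify y - complexify w) • complexify (a w)‖ ≤
      Real.exp 2 * (25 / 6 : ℝ) ^ ((Fintype.card ι : ℝ) / 2) * heatKernel (25 / 6 * ρ ^ 2) (x - w) *
        ‖a w‖ := by
  rw [complexify_add_I_smul_sub, norm_smul, norm_complexify]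
  refine mul_le_mul_of_nonneg_right (norm_heatKernelC_imShift_le hρ ?_) (norm_nonneg _)
  rw [norm_neg]
  linarith [norm_nonneg (x - w)]

/-- **The free-term estimate**: for a measurable field bounded by `M` and `‖y‖ ≤ ρ`,
`‖heatPotentialC ρ a (cx x + i cx y)‖ ≤ e² (25/6)^{d/2} M`. [cite: LemarieRieusset2016, Thm. 9.12 (proof, p. 262)] -/
theorem norm_heatPotentialC_le {a : EuclideanSpace ℝ ι → EuclideanSpace ℝ ι}
    {M : ℝ} (hM0 : 0 ≤ M) (hM : ∀ w, ‖a w‖ ≤ M)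
    {ρ : ℝ} (hρ : 0 < ρ) {x y : EuclideanSpace ℝ ι} (hy : ‖y‖ ≤ ρ) :
    ‖heatPotentialC ρ a (complexify x + Complex.I • complexify y)‖ ≤
      Real.exp 2 * (25 / 6 : ℝ) ^ ((Fintype.card ι : ℝ) / 2) * M := by
  rw [heatPotentialC_apply]
  have h := lintegral_heatKernelC_imShift_le hρ x (η := fun _ => -y)
    (fun w => by rw [norm_neg]; linarith [norm_nonneg (x - w)])
    (F := fun w => complexify (a w)) hM0 (fun w => by rw [norm_complexify]; exact hM w)
  have hnn : 0 ≤ Real.exp 2 * (25 / 6 : ℝ) ^ ((Fintype.card ι : ℝ) / 2) * M := by positivity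
  refine (norm_integral_le_lintegral_norm _).trans ?_
  rw [← ENNReal.ofReal_le_ofReal_iff hnn, ENNReal.ofReal_toReal]
  · refine le_trans (le_of_eq ?_) h
    refine lintegral_congr fun w => ?_
    rw [complexify_add_I_smul_sub, ← enorm_smul, ofReal_norm]
  · refine ne_top_of_le_ne_top ENNReal.ofReal_ne_top (le_trans (le_of_eq ?_) h)
    refine lintegral_congr fun w => ?_
    rw [complexify_add_I_smul_sub, ← enorm_smul, ofReal_norm]

/-! ### Holomorphy -/

/-- `ξ ↦ heatKernelC ρ ξ` is complex differentiable everywhere when `ρ ≠ 0`. [folklore] -/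
theorem differentiableAt_heatKernelC_sub {ρ : ℝ} (hρ : ρ ≠ 0) (c ζ : EuclideanSpace ℂ ι) :
    DifferentiableAt ℂ (fun ξ : EuclideanSpace ℂ ι => heatKernelC (ρ : ℂ) (ξ - c)) ζ :=
  (differentiableAt_const _).heatKernelC (differentiableAt_id.sub_const c) (Complex.ofReal_ne_zero.2 hρ)

/-- **A Gaussian envelope over a ball**: for `x' ∈ B̄(x₀, 1)`,
`G_c(x' - w) ≤ (4πc)^{-d/2} (𝟙_{‖x₀-w‖<2} + e^{-‖x₀-w‖²/(16c)})`. [folklore] -/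
theorem heatKernel_le_envelope {c : ℝ} (hc : 0 < c) {x₀ x' : EuclideanSpace ℝ ι}
    (hx' : ‖x' - x₀‖ ≤ 1) (w : EuclideanSpace ℝ ι) :
    heatKernel c (x' - w) ≤ (4 * π * c) ^ (-(Module.finrank ℝ (EuclideanSpace ℝ ι) : ℝ) / 2) *
      ((ball x₀ 2).indicator (fun _ => (1 : ℝ)) w + Real.exp (-‖x₀ - w‖ ^ 2 / (16 * c))) := by
  have hG := UnboundedOperators.heatKernel_le hc (x' - w)
  by_cases hw : w ∈ ball x₀ 2
  · rw [Set.indicator_of_mem hw]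
    refine hG.trans ?_
    have : 0 ≤ Real.exp (-‖x₀ - w‖ ^ 2 / (16 * c)) := (Real.exp_pos _).le
    nlinarith [Real.rpow_nonneg (show (0 : ℝ) ≤ 4 * π * c by positivity)
      (-(Module.finrank ℝ (EuclideanSpace ℝ ι) : ℝ) / 2)]
  · rw [Set.indicator_of_notMem hw, zero_add]
    have hfar : 2 ≤ ‖x₀ - w‖ := by
      have : ¬ dist w x₀ < 2 := hw
      rw [dist_eq_norm, ← norm_neg, neg_sub] at this
      linarith
    have hxw : ‖x₀ - w‖ / 2 ≤ ‖x' - w‖ := by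
      have := norm_sub_norm_le (x₀ - w) (x' - w)
      rw [show x₀ - w - (x' - w) = -(x' - x₀) by abel, norm_neg] at this
      linarith
    unfold UnboundedOperators.heatKernel
    refine mul_le_mul_of_nonneg_left (Real.exp_le_exp.2 ?_) (Real.rpow_nonneg (by positivity) _)
    rw [neg_div, neg_div, neg_le_neg_iff]
    have h2 : ‖x₀ - w‖ ^ 2 / 4 ≤ ‖x' - w‖ ^ 2 := by nlinarith [norm_nonneg (x₀ - w)]
    calc ‖x₀ - w‖ ^ 2 / (16 * c) = (‖x₀ - w‖ ^ 2 / 4) / (4 * c) := by field_simp; ring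
      _ ≤ ‖x' - w‖ ^ 2 / (4 * c) := by gcongr

/-- The Gaussian envelope is integrable. [folklore] -/
theorem integrable_envelope {c : ℝ} (hc : 0 < c) (x₀ : EuclideanSpace ℝ ι) :
    Integrable fun w : EuclideanSpace ℝ ι =>
      (ball x₀ 2).indicator (fun _ => (1 : ℝ)) w + Real.exp (-‖x₀ - w‖ ^ 2 / (16 * c)) := by
  refine ((integrable_indicator_iff measurableSet_ball).2
    (integrableOn_const measure_ball_lt_top.ne)).add ?_
  have h := (UnboundedOperators.integrable_heatKernel_holds (E := EuclideanSpace ℝ ι)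
    (show (0 : ℝ) < 4 * c by positivity)).comp_sub_left x₀
  have hk : (4 * π * (4 * c)) ^ (-(Module.finrank ℝ (EuclideanSpace ℝ ι) : ℝ) / 2) ≠ 0 :=
    (Real.rpow_pos_of_pos (by positivity) _).ne'
  refine ((h.const_mul ((4 * π * (4 * c)) ^ (-(Module.finrank ℝ (EuclideanSpace ℝ ι) : ℝ) / 2))⁻¹).congr
    (Eventually.of_forall fun w => ?_))
  simp only [UnboundedOperators.heatKernel]
  rw [← mul_assoc, inv_mul_cancel₀ hk, one_mul]
  congr 1
  field_simp
  ring

/-- **Holomorphy of the flat heat potential** of a measurable field bounded by `M`, on every open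
set of points `cx x + i cx y` with `‖y‖ < ρ` and `x` in the unit ball about a fixed centre
(every such open set; the centre only enters the dominating Gaussian envelope). [folklore] -/
theorem differentiableOn_heatPotentialC {a : EuclideanSpace ℝ ι → EuclideanSpace ℝ ι}
    (ha : AEStronglyMeasurable a volume) {M : ℝ} (hM : ∀ w, ‖a w‖ ≤ M)
    {ρ : ℝ} (hρ : 0 < ρ) (x₀ : EuclideanSpace ℝ ι) {V : Set (EuclideanSpace ℂ ι)} (hV : IsOpen V)
    (hadm : ∀ ζ ∈ V, ∃ x y : EuclideanSpace ℝ ι,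
      ζ = complexify x + Complex.I • complexify y ∧ ‖y‖ ≤ ρ ∧ ‖x - x₀‖ ≤ 1) :
    DifferentiableOn ℂ (heatPotentialC ρ a) V := by
  set d : ℝ := (Module.finrank ℝ (EuclideanSpace ℝ ι) : ℝ) with hd
  set c : ℝ := 25 / 6 * ρ ^ 2 with hcdef
  have hc : 0 < c := by positivity
  set K₀ : ℝ := Real.exp 2 * (25 / 6 : ℝ) ^ ((Fintype.card ι : ℝ) / 2) with hK₀
  show DifferentiableOn ℂ (fun ζ => ∫ w, heatKernelC (ρ : ℂ) (ζ - complexify w) • complexify (a w)) V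
  refine Literature.Analysis.Complex.differentiableOn_integral_of_dominated
    (F := fun ζ w => heatKernelC (ρ : ℂ) (ζ - complexify w) • complexify (a w)) ?_ ?_ ?_
  · exact fun ζ _ => aestronglyMeasurable_heatPotentialC_integrand ha hρ.ne' ζ
  · exact Eventually.of_forall fun w ζ _ =>
      ((differentiableAt_heatKernelC_sub hρ.ne' (complexify w) ζ).smul_const _).differentiableWithinAt
  · intro ζ₀ hζ₀
    obtain ⟨R, hR, hball⟩ := Metric.isOpen_iff.1 hV ζ₀ hζ₀
    refine ⟨R, hR, hball, fun w => K₀ * ((4 * π * c) ^ (-d / 2) *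
      ((ball x₀ 2).indicator (fun _ => (1 : ℝ)) w + Real.exp (-‖x₀ - w‖ ^ 2 / (16 * c)))) * M,
      (((integrable_envelope hc x₀).const_mul _).const_mul _).mul_const _,
      Eventually.of_forall fun w ζ hζ => ?_⟩
    obtain ⟨x, y, rfl, hy, hx⟩ := hadm ζ (hball hζ)
    refine (norm_heatPotentialC_integrand_le hρ hy a w).trans ?_
    have henv := heatKernel_le_envelope hc hx w
    rw [← hd] at henv
    have hK₀0 : 0 ≤ K₀ := by positivity
    have hE0 : 0 ≤ (4 * π * c) ^ (-d / 2) *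
        ((ball x₀ 2).indicator (fun _ => (1 : ℝ)) w + Real.exp (-‖x₀ - w‖ ^ 2 / (16 * c))) :=
      mul_nonneg (Real.rpow_nonneg (by positivity) _)
        (add_nonneg (Set.indicator_nonneg (fun _ _ => zero_le_one) _) (Real.exp_pos _).le)
    exact mul_le_mul (mul_le_mul_of_nonneg_left henv hK₀0) (hM w) (norm_nonneg _)
      (mul_nonneg hK₀0 hE0)

end Literature.Analysis.FluidPDE
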